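import Literature.NumberTheory.Automorphic.IntegratedOperatorLocalNonvanishing
import Mathlib.MeasureTheory.Group.Integral
import Mathlib.Analysis.InnerProductSpace.Basic
import Mathlib.Analysis.Normed.Module.FiniteDimension
import Mathlib.LinearAlgebra.Dual.Lemmas
import HarnessLib

/-!
# A vector whose cut-off matrix coefficient is an idempotent: the variational construction
(Gelbart, *Automorphic forms on adele groups* (1975), §10, (10.11): the normalised matrix
coefficients `ξ_v = d(π_v) conj ⟨π_v(g) u, u⟩` of a supercuspidal `π_v` are idempotents under
convolution modulo the centre — "orthogonality relations"; Harish-Chandra / Bernstein–Zelevinsky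
(1976), §2.40–2.44 for compact representations)

Topic `NumberTheory/Automorphic`; three auxiliary definitions with bodies (`cutCoeff`, `quadCoeff`,
`eCoeff`, in the namespace `CutoffCoefficient`) and theorems; no named fact, no instance visible
to importers.

Gelbart's test function at a ramified place is the idempotent `ξ_v = d conj ⟨π_v(g)u, u⟩` of the
Hecke algebra *modulo the centre*. In the tree's setting (test functions compactly supported on
the group itself, no central character) the same role is played by a matrix coefficient **cut off
to an open subgroup `G₀`** on which it is compactly supported (for `GL_n(F)`:
`G₀ = {g : |det g| = 1}`, on which supercuspidal coefficients are compactly supported):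
`e_u(h) = 1_{G₀}(h) ⟪F(ρ(h) u), F u⟫`, `F : V → H` an injective linear map to an inner product
space with `⟪F(ρ g x), F(ρ g y)⟫ = ⟪F x, F y⟫` (a unitary structure on the smooth representation
`ρ`; e.g. a local component of a unitary automorphic representation). The identity making `e_u`
an idempotent, `e_u ⋆ e_u = c e_u`, is `ρ(e_u) u = c u`, and for a *general* vector `u` it fails
(the restriction of `ρ` to `G₀` may be reducible). This file produces a good `u` **without any
structure theory for `ρ|_{G₀}`**, by a variational argument:

* `quadCoeff` — `Q₄(x, y, x', y') = ∫ c_{x,y}(h) conj c_{x',y'}(h) dμ` for the cut-off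
  coefficients `c_{x,y}(h) = 1_{G₀}(h) ⟪F x, F(ρ(h) y)⟫` (compactly supported by hypothesis,
  continuous by smoothness); sesquilinear, `Q₄(x,y,x',y') = conj Q₄(x',y',x,y)`, and — by the
  **inversion invariance** of `μ` (unimodularity) and unitarity —
  `Q₄(x,y,x',y') = Q₄(y',x',y,x)` (`quadCoeff_swap_inv`); `Q(x) = Q₄(x,x,x,x) = ∫ |c_{x,x}|² ≥ 0`,
  `> 0` for `x ≠ 0`.
* On the finite-dimensional space `E = V^{K₁}` of vectors fixed by a subgroup `K₁ ≤ G₀`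
  (admissibility), normed by `x ↦ ‖F x‖`, `Q` is continuous (a quartic form) and attains its
  maximum on the unit sphere at some `u`.
* **First-order condition** (`quadCoeff_eq_zero_of_isMaxOn`): for `w ∈ E`, `w ⊥ u`, the
  linear coefficient of `ε ↦ Q(u + εw)` is `4 Re Q₄(w,u,u,u)` (by the two symmetries), and
  maximality on the sphere (`Q` is homogeneous of degree `4`) forces it to vanish; with `w ↦ iw`,
  `Q₄(w,u,u,u) = 0`.
* `Q₄(w,u,u,u) = ∫ e_u(h) ⟪F w, F(ρ(h) u)⟫ dh = ⟪F w, F(T u)⟫` for the Hecke-sum vector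
  `T u = Σ_γ (∫_{γK} e_u) ρ(γ̃) u` (`apply_sum_setIntegral_smul_eq_integral`), which lies in `E`
  (left `K₁`-invariance of `e_u` and of `μ`); so `T u ⊥ (E ⊖ u)`, i.e. **`T u = c u`** with
  `c = Q(u) > 0`.
* `exists_eCoeff_eigenvector` — **main theorem**: there is `u ∈ V^{K₁}` with
  `‖F u‖ = 1` and `c > 0` such that `∫ e_u(h) ũ(ρ(h) u) dμ(h) = c ũ(u)` for every linear form `ũ`
  on `V`. Consequences (separate file): `e_u ⋆ e_u = c e_u`, `e_u^* = e_u`, `ρ(e_u) u = c u ≠ 0`.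

## References

* S. Gelbart, *Automorphic forms on adele groups*, Ann. of Math. Studies 83 (1975), §10, (10.11),
  pp. 151–153 [Gelbart1975].
* I. N. Bernstein, A. V. Zelevinsky, *Representations of the group `GL(n, F)` where `F` is a
  non-archimedean local field*, Russian Math. Surveys 31:3 (1976), §2.40–2.44
  [BernsteinZelevinsky1976].
-/

noncomputable section

open MeasureTheory Measure Set Filter Topology
open scoped ComplexConjugate InnerProductSpace

namespace Literature.NumberTheory.Automorphic

namespace CutoffCoefficient

section Algebra

variable {G : Type*} [Group G]
  {V : Type*} [AddCommGroup V] [Module ℂ V] (ρ : Representation ℂ G V)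
  {H : Type*} [NormedAddCommGroup H] [InnerProductSpace ℂ H]
  (F : V →ₗ[ℂ] H) (G₀ : Subgroup G)

/-! ### The cut-off coefficients `c_{x,y}(h) = 1_{G₀}(h) ⟪F x, F(ρ(h) y)⟫` -/

/-- The **cut-off matrix coefficient** `c_{x,y}(h) = 1_{G₀}(h) ⟪F x, F(ρ(h) y)⟫`
(conjugate-linear in `x`, linear in `y`). [cite: Gelbart1975, (10.11)] -/
def cutCoeff (x y : V) (h : G) : ℂ :=
  (G₀ : Set G).indicator (fun h => ⟪F x, F (ρ h y)⟫_ℂ) h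

variable {ρ F G₀}

/-- Unfolding `cutCoeff`. [folklore] -/
theorem cutCoeff_apply (x y : V) (h : G) :
    cutCoeff ρ F G₀ x y h = (G₀ : Set G).indicator (fun h => ⟪F x, F (ρ h y)⟫_ℂ) h := rfl

/-- On `G₀` the cut-off coefficient is the matrix coefficient. [folklore] -/
theorem cutCoeff_of_mem {h : G} (hh : h ∈ G₀) (x y : V) :
    cutCoeff ρ F G₀ x y h = ⟪F x, F (ρ h y)⟫_ℂ :=
  Set.indicator_of_mem (s := (G₀ : Set G)) hh _

/-- Off `G₀` the cut-off coefficient vanishes. [folklore] -/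
theorem cutCoeff_of_not_mem {h : G} (hh : h ∉ G₀) (x y : V) : cutCoeff ρ F G₀ x y h = 0 :=
  Set.indicator_of_notMem (s := (G₀ : Set G)) hh _

/-- Additivity in the first vector. [folklore] -/
theorem cutCoeff_add_left (x x' y : V) (h : G) :
    cutCoeff ρ F G₀ (x + x') y h = cutCoeff ρ F G₀ x y h + cutCoeff ρ F G₀ x' y h := by
  by_cases hh : h ∈ G₀
  · simp only [cutCoeff_of_mem hh, map_add, inner_add_left]
  · simp only [cutCoeff_of_not_mem hh, add_zero]

/-- Additivity in the second vector. [folklore] -/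
theorem cutCoeff_add_right (x y y' : V) (h : G) :
    cutCoeff ρ F G₀ x (y + y') h = cutCoeff ρ F G₀ x y h + cutCoeff ρ F G₀ x y' h := by
  by_cases hh : h ∈ G₀
  · simp only [cutCoeff_of_mem hh, map_add, inner_add_right]
  · simp only [cutCoeff_of_not_mem hh, add_zero]

/-- Conjugate-linearity in the first vector. [folklore] -/
theorem cutCoeff_smul_left (a : ℂ) (x y : V) (h : G) :
    cutCoeff ρ F G₀ (a • x) y h = conj a * cutCoeff ρ F G₀ x y h := by
  by_cases hh : h ∈ G₀
  · simp only [cutCoeff_of_mem hh, map_smul, inner_smul_left]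
  · simp only [cutCoeff_of_not_mem hh, mul_zero]

/-- Linearity in the second vector. [folklore] -/
theorem cutCoeff_smul_right (a : ℂ) (x y : V) (h : G) :
    cutCoeff ρ F G₀ x (a • y) h = a * cutCoeff ρ F G₀ x y h := by
  by_cases hh : h ∈ G₀
  · simp only [cutCoeff_of_mem hh, map_smul, inner_smul_right]
  · simp only [cutCoeff_of_not_mem hh, mul_zero]

/-- **Unitarity turns inversion into conjugation**: `c_{x,y}(h⁻¹) = conj c_{y,x}(h)`
(`⟪F x, F(ρ(h⁻¹) y)⟫ = ⟪F(ρ(h) x), F y⟫`). [folklore] -/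
theorem cutCoeff_inv (hF : ∀ (g : G) (x y : V), ⟪F (ρ g x), F (ρ g y)⟫_ℂ = ⟪F x, F y⟫_ℂ)
    (x y : V) (h : G) : cutCoeff ρ F G₀ x y h⁻¹ = conj (cutCoeff ρ F G₀ y x h) := by
  by_cases hh : h ∈ G₀
  · rw [cutCoeff_of_mem (G₀.inv_mem hh), cutCoeff_of_mem hh, ← hF h x (ρ h⁻¹ y),
      ← Module.End.mul_apply, ← map_mul, mul_inv_cancel, map_one, Module.End.one_apply,
      inner_conj_symm]
  · have hh' : h⁻¹ ∉ G₀ := fun h' => hh (by simpa using G₀.inv_mem h')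
    rw [cutCoeff_of_not_mem hh', cutCoeff_of_not_mem hh, map_zero]

end Algebra

section Topology

variable {G : Type*} [Group G] [TopologicalSpace G] [IsTopologicalGroup G]
  {V : Type*} [AddCommGroup V] [Module ℂ V] {ρ : Representation ℂ G V}
  {H : Type*} [NormedAddCommGroup H] [InnerProductSpace ℂ H]
  {F : V →ₗ[ℂ] H} {G₀ : Subgroup G}

/-- The cut-off coefficients are right invariant under `Stab(y) ∩ G₀`, hence continuous when
`G₀` and the stabiliser are open (`continuous_of_right_invariant`). [folklore] -/
theorem continuous_cutCoeff (hG₀ : IsOpen (G₀ : Set G)) {y : V} (hy : ρ.IsSmoothVector y) (x : V) :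
    Continuous (cutCoeff ρ F G₀ x y) := by
  refine continuous_of_right_invariant (K := ρ.stabilizerSubgroup y ⊓ G₀) (hy.inter hG₀) fun g k hk => ?_
  have hk1 : ρ k y = y := (ρ.mem_stabilizerSubgroup y k).1 hk.1
  by_cases hg : g ∈ G₀
  · rw [cutCoeff_of_mem (G₀.mul_mem hg hk.2), cutCoeff_of_mem hg, map_mul, Module.End.mul_apply, hk1]
  · have hgk : g * k ∉ G₀ := fun h => hg (by simpa using G₀.mul_mem h (G₀.inv_mem hk.2))
    rw [cutCoeff_of_not_mem hgk, cutCoeff_of_not_mem hg]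

end Topology

/-! ### The quartic form `Q₄(x,y,x',y') = ∫ c_{x,y} conj c_{x',y'}` -/

section QuadDef

variable {G : Type*} [Group G] [MeasurableSpace G]
  {V : Type*} [AddCommGroup V] [Module ℂ V] {ρ : Representation ℂ G V}
  {H : Type*} [NormedAddCommGroup H] [InnerProductSpace ℂ H]
  {F : V →ₗ[ℂ] H} {G₀ : Subgroup G} {μ : Measure G}

variable (ρ F G₀ μ) in
/-- The **quartic form** `Q₄(x, y, x', y') = ∫ c_{x,y}(h) conj c_{x',y'}(h) dμ(h)` of the cut-off
coefficients (conjugate-linear in `x`, `y'`, linear in `y`, `x'`). [cite: Gelbart1975, (10.11)] -/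
def quadCoeff (x y x' y' : V) : ℂ :=
  ∫ h, cutCoeff ρ F G₀ x y h * conj (cutCoeff ρ F G₀ x' y' h) ∂μ

/-- Unfolding `quadCoeff`. [folklore] -/
theorem quadCoeff_apply (x y x' y' : V) :
    quadCoeff ρ F G₀ μ x y x' y' = ∫ h, cutCoeff ρ F G₀ x y h * conj (cutCoeff ρ F G₀ x' y' h) ∂μ := rfl

/-- Conjugate-linearity of `Q₄` in the first slot. [folklore] -/
theorem quadCoeff_smul₁ (a : ℂ) (x y x' y' : V) :
    quadCoeff ρ F G₀ μ (a • x) y x' y' = conj a * quadCoeff ρ F G₀ μ x y x' y' := by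
  simp only [quadCoeff_apply, cutCoeff_smul_left, mul_assoc]
  exact integral_const_mul _ _

/-- Linearity of `Q₄` in the second slot. [folklore] -/
theorem quadCoeff_smul₂ (a : ℂ) (x y x' y' : V) :
    quadCoeff ρ F G₀ μ x (a • y) x' y' = a * quadCoeff ρ F G₀ μ x y x' y' := by
  simp only [quadCoeff_apply, cutCoeff_smul_right, mul_assoc]
  exact integral_const_mul _ _

/-- Linearity of `Q₄` in the third slot. [folklore] -/
theorem quadCoeff_smul₃ (a : ℂ) (x y x' y' : V) :
    quadCoeff ρ F G₀ μ x y (a • x') y' = a * quadCoeff ρ F G₀ μ x y x' y' := by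
  simp only [quadCoeff_apply, cutCoeff_smul_left, map_mul, Complex.conj_conj]
  rw [← integral_const_mul]
  congr 1 with h
  ring

/-- Conjugate-linearity of `Q₄` in the fourth slot. [folklore] -/
theorem quadCoeff_smul₄ (a : ℂ) (x y x' y' : V) :
    quadCoeff ρ F G₀ μ x y x' (a • y') = conj a * quadCoeff ρ F G₀ μ x y x' y' := by
  simp only [quadCoeff_apply, cutCoeff_smul_right, map_mul]
  rw [← integral_const_mul]
  congr 1 with h
  ring

/-- `Q₄` vanishes when the first slot is `0`. [folklore] -/
theorem quadCoeff_zero₁ (y x' y' : V) : quadCoeff ρ F G₀ μ 0 y x' y' = 0 := by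
  have h := quadCoeff_smul₁ (ρ := ρ) (F := F) (G₀ := G₀) (μ := μ) 0 0 y x' y'
  rwa [zero_smul, map_zero, zero_mul] at h

/-- `Q₄` vanishes when the second slot is `0`. [folklore] -/
theorem quadCoeff_zero₂ (x x' y' : V) : quadCoeff ρ F G₀ μ x 0 x' y' = 0 := by
  have h := quadCoeff_smul₂ (ρ := ρ) (F := F) (G₀ := G₀) (μ := μ) 0 x 0 x' y'
  rwa [zero_smul, zero_mul] at h

/-- `Q₄` vanishes when the third slot is `0`. [folklore] -/
theorem quadCoeff_zero₃ (x y y' : V) : quadCoeff ρ F G₀ μ x y 0 y' = 0 := by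
  have h := quadCoeff_smul₃ (ρ := ρ) (F := F) (G₀ := G₀) (μ := μ) 0 x y 0 y'
  rwa [zero_smul, zero_mul] at h

/-- `Q₄` vanishes when the fourth slot is `0`. [folklore] -/
theorem quadCoeff_zero₄ (x y x' : V) : quadCoeff ρ F G₀ μ x y x' 0 = 0 := by
  have h := quadCoeff_smul₄ (ρ := ρ) (F := F) (G₀ := G₀) (μ := μ) 0 x y x' 0
  rwa [zero_smul, map_zero, zero_mul] at h

/-- **Hermitian symmetry**: `Q₄(x,y,x',y') = conj Q₄(x',y',x,y)`. [folklore] -/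
theorem quadCoeff_conj_symm (x y x' y' : V) :
    quadCoeff ρ F G₀ μ x y x' y' = conj (quadCoeff ρ F G₀ μ x' y' x y) := by
  rw [quadCoeff_apply, quadCoeff_apply, ← integral_conj]
  congr 1 with h
  rw [map_mul, Complex.conj_conj, mul_comm]

/-- **The inversion symmetry** (unimodularity): for `μ` invariant under `h ↦ h⁻¹` and `F`
unitary, `Q₄(x,y,x',y') = Q₄(y',x',y,x)` — substitute `h ↦ h⁻¹` and use
`c_{x,y}(h⁻¹) = conj c_{y,x}(h)`. [folklore] -/
theorem quadCoeff_swap_inv [MeasurableInv G] [μ.IsInvInvariant]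
    (hF : ∀ (g : G) (x y : V), ⟪F (ρ g x), F (ρ g y)⟫_ℂ = ⟪F x, F y⟫_ℂ) (x y x' y' : V) :
    quadCoeff ρ F G₀ μ x y x' y' = quadCoeff ρ F G₀ μ y' x' y x := by
  rw [quadCoeff_apply, quadCoeff_apply,
    ← integral_inv_eq_self (fun h => cutCoeff ρ F G₀ y' x' h * conj (cutCoeff ρ F G₀ y x h)) μ]
  congr 1 with h
  rw [cutCoeff_inv hF, cutCoeff_inv hF, Complex.conj_conj, mul_comm]

/-- **`Q(x) = Q₄(x,x,x,x) = ∫ ‖c_{x,x}‖²`** is real and non-negative. [folklore] -/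
theorem quadCoeff_self_eq_integral_norm_sq (x : V) :
    quadCoeff ρ F G₀ μ x x x x = ((∫ h, ‖cutCoeff ρ F G₀ x x h‖ ^ 2 ∂μ : ℝ) : ℂ) := by
  rw [quadCoeff_apply, ← integral_complex_ofReal]
  congr 1 with h
  rw [Complex.mul_conj, Complex.normSq_eq_norm_sq, Complex.ofReal_pow]

/-- `Q(x)` has zero imaginary part. [folklore] -/
theorem quadCoeff_self_im (x : V) : (quadCoeff ρ F G₀ μ x x x x).im = 0 := by
  rw [quadCoeff_self_eq_integral_norm_sq, Complex.ofReal_im]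

/-- `Q(x) ≥ 0`. [folklore] -/
theorem quadCoeff_self_re_nonneg (x : V) : 0 ≤ (quadCoeff ρ F G₀ μ x x x x).re := by
  rw [quadCoeff_self_eq_integral_norm_sq, Complex.ofReal_re]
  exact integral_nonneg fun h => sq_nonneg _

end QuadDef

section QuadTop

variable {G : Type*} [Group G] [TopologicalSpace G] [IsTopologicalGroup G] [MeasurableSpace G]
  [BorelSpace G]
  {V : Type*} [AddCommGroup V] [Module ℂ V] {ρ : Representation ℂ G V}
  {H : Type*} [NormedAddCommGroup H] [InnerProductSpace ℂ H]
  {F : V →ₗ[ℂ] H} {G₀ : Subgroup G}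
  (hG₀ : IsOpen (G₀ : Set G)) (hsm : ρ.IsSmooth)
  (hcs : ∀ x y : V, HasCompactSupport (cutCoeff ρ F G₀ x y)) (μ : Measure G)

include hG₀ hsm hcs

/-- The integrand of `Q₄` is integrable (continuous with compact support). [folklore] -/
theorem integrable_cutCoeff_mul_conj [IsFiniteMeasureOnCompacts μ] (x y x' y' : V) :
    Integrable (fun h => cutCoeff ρ F G₀ x y h * conj (cutCoeff ρ F G₀ x' y' h)) μ :=
  ((continuous_cutCoeff hG₀ (hsm y) x).mul
    (Complex.continuous_conj.comp (continuous_cutCoeff hG₀ (hsm y') x'))).integrable_of_hasCompactSupport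
    ((hcs x y).mul_right)

/-- Additivity of `Q₄` in the first slot. [folklore] -/
theorem quadCoeff_add₁ [IsFiniteMeasureOnCompacts μ] (x₁ x₂ y x' y' : V) :
    quadCoeff ρ F G₀ μ (x₁ + x₂) y x' y' = quadCoeff ρ F G₀ μ x₁ y x' y' + quadCoeff ρ F G₀ μ x₂ y x' y' := by
  simp only [quadCoeff_apply, cutCoeff_add_left, add_mul]
  exact integral_add (integrable_cutCoeff_mul_conj hG₀ hsm hcs μ _ _ _ _)
    (integrable_cutCoeff_mul_conj hG₀ hsm hcs μ _ _ _ _)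

/-- Additivity of `Q₄` in the second slot. [folklore] -/
theorem quadCoeff_add₂ [IsFiniteMeasureOnCompacts μ] (x y₁ y₂ x' y' : V) :
    quadCoeff ρ F G₀ μ x (y₁ + y₂) x' y' = quadCoeff ρ F G₀ μ x y₁ x' y' + quadCoeff ρ F G₀ μ x y₂ x' y' := by
  simp only [quadCoeff_apply, cutCoeff_add_right, add_mul]
  exact integral_add (integrable_cutCoeff_mul_conj hG₀ hsm hcs μ _ _ _ _)
    (integrable_cutCoeff_mul_conj hG₀ hsm hcs μ _ _ _ _)

/-- Additivity of `Q₄` in the third slot. [folklore] -/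
theorem quadCoeff_add₃ [IsFiniteMeasureOnCompacts μ] (x y x'₁ x'₂ y' : V) :
    quadCoeff ρ F G₀ μ x y (x'₁ + x'₂) y' = quadCoeff ρ F G₀ μ x y x'₁ y' + quadCoeff ρ F G₀ μ x y x'₂ y' := by
  simp only [quadCoeff_apply, cutCoeff_add_left, map_add, mul_add]
  exact integral_add (integrable_cutCoeff_mul_conj hG₀ hsm hcs μ _ _ _ _)
    (integrable_cutCoeff_mul_conj hG₀ hsm hcs μ _ _ _ _)

/-- Additivity of `Q₄` in the fourth slot. [folklore] -/
theorem quadCoeff_add₄ [IsFiniteMeasureOnCompacts μ] (x y x' y'₁ y'₂ : V) :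
    quadCoeff ρ F G₀ μ x y x' (y'₁ + y'₂) = quadCoeff ρ F G₀ μ x y x' y'₁ + quadCoeff ρ F G₀ μ x y x' y'₂ := by
  simp only [quadCoeff_apply, cutCoeff_add_right, map_add, mul_add]
  exact integral_add (integrable_cutCoeff_mul_conj hG₀ hsm hcs μ _ _ _ _)
    (integrable_cutCoeff_mul_conj hG₀ hsm hcs μ _ _ _ _)

/-- **`Q(x) > 0` for `x ≠ 0`** when `F` is injective and `μ` charges open sets: `‖c_{x,x}‖²` is
continuous, non-negative, compactly supported and equal to `‖F x‖⁴ > 0` at `h = 1`. [folklore] -/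
theorem quadCoeff_self_re_pos [IsFiniteMeasureOnCompacts μ] [μ.IsOpenPosMeasure] (hFi : Function.Injective F) {x : V} (hx : x ≠ 0) :
    0 < (quadCoeff ρ F G₀ μ x x x x).re := by
  rw [quadCoeff_self_eq_integral_norm_sq, Complex.ofReal_re]
  have hc : Continuous fun h => ‖cutCoeff ρ F G₀ x x h‖ ^ 2 :=
    (continuous_cutCoeff hG₀ (hsm x) x).norm.pow 2
  have hs : HasCompactSupport fun h => ‖cutCoeff ρ F G₀ x x h‖ ^ 2 :=
    (hcs x x).norm.comp_left (g := fun t : ℝ => t ^ 2) (by simp)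
  refine hc.integral_pos_of_hasCompactSupport_nonneg_nonzero hs (fun h => sq_nonneg _) (x := 1) ?_
  have hFx : F x ≠ 0 := fun h0 => hx (hFi (by rw [h0, map_zero]))
  change ‖cutCoeff ρ F G₀ x x 1‖ ^ 2 ≠ 0
  rw [cutCoeff_of_mem G₀.one_mem, map_one, Module.End.one_apply]
  exact pow_ne_zero 2 (norm_ne_zero_iff.2 (inner_self_ne_zero.2 hFx))

end QuadTop


/-! ### The idempotent candidate `e_u = conj c_{u,u}` and its Hecke vector `T u` -/

section Hecke

variable {G : Type*} [Group G] [TopologicalSpace G] [IsTopologicalGroup G] [MeasurableSpace G]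
  [BorelSpace G]
  {V : Type*} [AddCommGroup V] [Module ℂ V] {ρ : Representation ℂ G V}
  {H : Type*} [NormedAddCommGroup H] [InnerProductSpace ℂ H]
  {F : V →ₗ[ℂ] H} {G₀ : Subgroup G}

variable (ρ F G₀) in
/-- **The cut-off conjugate coefficient `e_u(h) = 1_{G₀}(h) ⟪F(ρ(h) u), F u⟫ = conj c_{u,u}(h)`** —
Gelbart's `ξ_v = d · conj ⟨π_v(g) u, u⟩` ((10.11)), cut off to `G₀` instead of being taken modulo
the centre. [cite: Gelbart1975, (10.11)] -/
def eCoeff (u : V) (h : G) : ℂ := conj (cutCoeff ρ F G₀ u u h)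

omit [TopologicalSpace G] [IsTopologicalGroup G] [MeasurableSpace G] [BorelSpace G] in
/-- Unfolding `eCoeff`. [folklore] -/
theorem eCoeff_apply (u : V) (h : G) : eCoeff ρ F G₀ u h = conj (cutCoeff ρ F G₀ u u h) := rfl

omit [TopologicalSpace G] [IsTopologicalGroup G] [MeasurableSpace G] [BorelSpace G] in
/-- On `G₀`, `e_u(h) = ⟪F(ρ(h) u), F u⟫`. [folklore] -/
theorem eCoeff_of_mem {h : G} (hh : h ∈ G₀) (u : V) : eCoeff ρ F G₀ u h = ⟪F (ρ h u), F u⟫_ℂ := by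
  rw [eCoeff_apply, cutCoeff_of_mem hh, inner_conj_symm]

omit [TopologicalSpace G] [IsTopologicalGroup G] [MeasurableSpace G] [BorelSpace G] in
/-- Off `G₀`, `e_u = 0`. [folklore] -/
theorem eCoeff_of_not_mem {h : G} (hh : h ∉ G₀) (u : V) : eCoeff ρ F G₀ u h = 0 := by
  rw [eCoeff_apply, cutCoeff_of_not_mem hh, map_zero]

omit [MeasurableSpace G] [BorelSpace G] in
/-- `e_u` is continuous (for `u` smooth, `G₀` open). [folklore] -/
theorem continuous_eCoeff (hG₀ : IsOpen (G₀ : Set G)) {u : V} (hu : ρ.IsSmoothVector u) :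
    Continuous (eCoeff ρ F G₀ u) :=
  Complex.continuous_conj.comp (continuous_cutCoeff hG₀ hu u)

omit [IsTopologicalGroup G] [MeasurableSpace G] [BorelSpace G] in
/-- `e_u` has compact support when `c_{u,u}` has. [folklore] -/
theorem hasCompactSupport_eCoeff {u : V} (hcs : HasCompactSupport (cutCoeff ρ F G₀ u u)) :
    HasCompactSupport (eCoeff ρ F G₀ u) :=
  hcs.comp_left (g := fun z : ℂ => conj z) (map_zero _)

omit [TopologicalSpace G] [IsTopologicalGroup G] [MeasurableSpace G] [BorelSpace G] in
/-- **Left invariance of `e_u` under a subgroup `K₁ ≤ G₀` fixing `u`** (unitarity):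
`e_u(k⁻¹ h) = ⟪F(ρ(h) u), F(ρ(k) u)⟫ = e_u(h)`. [folklore] -/
theorem eCoeff_inv_mul_of_mem (hF : ∀ (g : G) (x y : V), ⟪F (ρ g x), F (ρ g y)⟫_ℂ = ⟪F x, F y⟫_ℂ)
    {K₁ : Subgroup G} (hK₁ : K₁ ≤ G₀) {u : V} (hu : u ∈ ρ.fixedPoints K₁) {k : G} (hk : k ∈ K₁) (h : G) :
    eCoeff ρ F G₀ u (k⁻¹ * h) = eCoeff ρ F G₀ u h := by
  have hku : ρ k u = u := (ρ.mem_fixedPoints K₁ u).1 hu k hk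
  by_cases hh : h ∈ G₀
  · have hkh : k⁻¹ * h ∈ G₀ := G₀.mul_mem (G₀.inv_mem (hK₁ hk)) hh
    rw [eCoeff_of_mem hkh, eCoeff_of_mem hh, ← hF k (ρ (k⁻¹ * h) u) u, ← Module.End.mul_apply,
      ← map_mul, mul_inv_cancel_left, hku]
  · have hkh : k⁻¹ * h ∉ G₀ := fun h' => hh (by simpa using G₀.mul_mem (hK₁ hk) h')
    rw [eCoeff_of_not_mem hkh, eCoeff_of_not_mem hh]

variable (hG₀ : IsOpen (G₀ : Set G)) (hsm : ρ.IsSmooth)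
  (hcs : ∀ x y : V, HasCompactSupport (cutCoeff ρ F G₀ x y)) (μ : Measure G)

include hG₀ hsm hcs in
/-- **The Hecke vector `T u`**: there is `t ∈ V` with `ũ(t) = ∫ e_u(h) ũ(ρ(h) u) dμ(h)` for every
linear form `ũ` — namely the finite Hecke sum `Σ_γ (∫_{γ Stab(u)} e_u) ρ(γ̃) u` over cosets covering
the support of `e_u` (`apply_sum_setIntegral_smul_eq_integral`); `t` plays the role of `ρ(e_u) u`.
[folklore] -/
theorem exists_heckeVector [IsFiniteMeasureOnCompacts μ] (u : V) :
    ∃ t : V, ∀ ut : Module.Dual ℂ V, ut t = ∫ h, eCoeff ρ F G₀ u h * ut (ρ h u) ∂μ := by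
  obtain ⟨T, hT⟩ := exists_finset_tsupport_subset_biUnion_coset (ρ.stabilizerSubgroup u) (hsm u)
    (hasCompactSupport_eCoeff (hcs u u))
  exact ⟨∑ γ ∈ T, (∫ g in {g : G | (g : G ⧸ ρ.stabilizerSubgroup u) = γ}, eCoeff ρ F G₀ u g ∂μ) • ρ γ.out u,
    fun ut => apply_sum_setIntegral_smul_eq_integral μ (hsm u) (continuous_eCoeff hG₀ (hsm u))
      (hasCompactSupport_eCoeff (hcs u u)) hT ut⟩

omit [TopologicalSpace G] [IsTopologicalGroup G] [BorelSpace G] in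
/-- **`T u ∈ V^{K₁}` for `u ∈ V^{K₁}`, `K₁ ≤ G₀`**: for `k ∈ K₁`,
`ũ(ρ(k) T u) = ∫ e_u(h) ũ(ρ(kh) u) = ∫ e_u(k⁻¹ h) ũ(ρ(h) u) = ũ(T u)` by left invariance of `μ` and
of `e_u`; linear forms separate points. [folklore] -/
theorem heckeVector_mem_fixedPoints [μ.IsMulLeftInvariant] [MeasurableMul G]
    (hF : ∀ (g : G) (x y : V), ⟪F (ρ g x), F (ρ g y)⟫_ℂ = ⟪F x, F y⟫_ℂ)
    {K₁ : Subgroup G} (hK₁ : K₁ ≤ G₀) {u : V} (hu : u ∈ ρ.fixedPoints K₁) {t : V}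
    (ht : ∀ ut : Module.Dual ℂ V, ut t = ∫ h, eCoeff ρ F G₀ u h * ut (ρ h u) ∂μ) :
    t ∈ ρ.fixedPoints K₁ := by
  rw [ρ.mem_fixedPoints]
  intro k hk
  rw [← sub_eq_zero]
  refine (Module.forall_dual_apply_eq_zero_iff ℂ (ρ k t - t)).1 fun ut => ?_
  rw [map_sub, sub_eq_zero]
  have h1 : ut (ρ k t) = (ut ∘ₗ (ρ k)) t := rfl
  rw [h1, ht, ht]
  have h2 : (fun h => eCoeff ρ F G₀ u h * (ut ∘ₗ (ρ k)) (ρ h u)) =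
      fun h => (fun h' => eCoeff ρ F G₀ u (k⁻¹ * h') * ut (ρ h' u)) (k * h) := by
    funext h
    simp only [LinearMap.comp_apply, inv_mul_cancel_left, map_mul]
    rfl
  rw [h2, integral_mul_left_eq_self (fun h' => eCoeff ρ F G₀ u (k⁻¹ * h') * ut (ρ h' u)) k]
  congr 1 with h
  rw [eCoeff_inv_mul_of_mem hF hK₁ hu hk]

end Hecke


/-! ### The variational argument -/

section Variational

variable {G : Type*} [Group G] [TopologicalSpace G] [IsTopologicalGroup G] [MeasurableSpace G]
  [BorelSpace G]
  {V : Type*} [AddCommGroup V] [Module ℂ V] {ρ : Representation ℂ G V}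
  {H : Type*} [NormedAddCommGroup H] [InnerProductSpace ℂ H]
  {F : V →ₗ[ℂ] H} {G₀ : Subgroup G}

/-- **Elementary**: if `ε L + ε² a + ε³ b + ε⁴ c ≤ 0` for all real `ε`, then `L = 0` (divide by
small `ε` of both signs). [folklore] -/
theorem eq_zero_of_forall_quartic_le {L a b c : ℝ}
    (h : ∀ ε : ℝ, ε * L + ε ^ 2 * a + ε ^ 3 * b + ε ^ 4 * c ≤ 0) : L = 0 := by
  -- the case `L > 0` for a general quartic of this shape
  have key : ∀ L' a' b' c' : ℝ, (∀ ε : ℝ, ε * L' + ε ^ 2 * a' + ε ^ 3 * b' + ε ^ 4 * c' ≤ 0) → ¬ 0 < L' := by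
    intro L' a' b' c' h' hL'
    set M : ℝ := |a'| + |b'| + |c'| + 1 with hM
    have hM0 : 0 < M := by positivity
    set ε : ℝ := min (1 / 2) (L' / (2 * M)) with hε
    have hε0 : 0 < ε := lt_min (by norm_num) (div_pos hL' (by positivity))
    have hε1 : ε ≤ 1 := (min_le_left _ _).trans (by norm_num)
    have hεL : ε * M ≤ L' / 2 := by
      have : ε ≤ L' / (2 * M) := min_le_right _ _
      calc ε * M ≤ L' / (2 * M) * M := mul_le_mul_of_nonneg_right this hM0.le
        _ = L' / 2 := by field_simp
    have hpow2 : ε ^ 2 ≤ ε ^ 2 := le_rfl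
    have hpow3 : ε ^ 3 ≤ ε ^ 2 := by
      calc ε ^ 3 = ε ^ 2 * ε := by ring
        _ ≤ ε ^ 2 * 1 := mul_le_mul_of_nonneg_left hε1 (by positivity)
        _ = ε ^ 2 := mul_one _
    have hpow4 : ε ^ 4 ≤ ε ^ 2 := by
      calc ε ^ 4 = ε ^ 2 * (ε * ε) := by ring
        _ ≤ ε ^ 2 * 1 := mul_le_mul_of_nonneg_left (by nlinarith) (by positivity)
        _ = ε ^ 2 := mul_one _
    have h1 : -(ε ^ 2 * |a'|) ≤ ε ^ 2 * a' := by
      have := neg_abs_le a'; nlinarith [sq_nonneg ε]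
    have h2 : -(ε ^ 2 * |b'|) ≤ ε ^ 3 * b' := by
      have hb := neg_abs_le b'; have hb' := le_abs_self b'
      nlinarith [hpow3, abs_nonneg b', pow_pos hε0 3]
    have h3 : -(ε ^ 2 * |c'|) ≤ ε ^ 4 * c' := by
      have hc := neg_abs_le c'; have hc' := le_abs_self c'
      nlinarith [hpow4, abs_nonneg c', pow_pos hε0 4]
    have hsum : ε * L' - ε ^ 2 * (|a'| + |b'| + |c'|) ≤ ε * L' + ε ^ 2 * a' + ε ^ 3 * b' + ε ^ 4 * c' := by
      linarith
    have hlow : 0 < ε * L' - ε ^ 2 * (|a'| + |b'| + |c'|) := by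
      have : ε ^ 2 * (|a'| + |b'| + |c'|) ≤ ε ^ 2 * M := by
        apply mul_le_mul_of_nonneg_left _ (by positivity); linarith
      have h4 : ε ^ 2 * M = ε * (ε * M) := by ring
      nlinarith [hεL, hε0, hL']
    linarith [h' ε]
  rcases lt_trichotomy L 0 with hL | hL | hL
  · -- `L < 0`: apply the key step to `ε ↦ -ε`
    exfalso
    refine key (-L) a (-b) c (fun ε => ?_) (by linarith)
    have := h (-ε)
    have e1 : -ε * L + (-ε) ^ 2 * a + (-ε) ^ 3 * b + (-ε) ^ 4 * c =
        ε * -L + ε ^ 2 * a + ε ^ 3 * -b + ε ^ 4 * c := by ring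
    linarith [e1]
  · exact hL
  · exact absurd hL (key L a b c h)

variable (hG₀ : IsOpen (G₀ : Set G)) (hsm : ρ.IsSmooth)
  (hcs : ∀ x y : V, HasCompactSupport (cutCoeff ρ F G₀ x y)) (μ : Measure G)

include hG₀ hsm hcs

/-- **Expansion of `Q(u + ε w)`** in powers of the real parameter `ε` (sesquilinearity of `Q₄`;
`conj ε = ε`). [folklore] -/
theorem quadCoeff_self_add_smul [IsFiniteMeasureOnCompacts μ] (u w : V) (ε : ℝ) :
    quadCoeff ρ F G₀ μ (u + (ε : ℂ) • w) (u + (ε : ℂ) • w) (u + (ε : ℂ) • w) (u + (ε : ℂ) • w) =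
      quadCoeff ρ F G₀ μ u u u u
      + (ε : ℂ) * (quadCoeff ρ F G₀ μ w u u u + quadCoeff ρ F G₀ μ u w u u
          + quadCoeff ρ F G₀ μ u u w u + quadCoeff ρ F G₀ μ u u u w)
      + (ε : ℂ) ^ 2 * (quadCoeff ρ F G₀ μ w w u u + quadCoeff ρ F G₀ μ w u w u
          + quadCoeff ρ F G₀ μ w u u w + quadCoeff ρ F G₀ μ u w w u
          + quadCoeff ρ F G₀ μ u w u w + quadCoeff ρ F G₀ μ u u w w)
      + (ε : ℂ) ^ 3 * (quadCoeff ρ F G₀ μ u w w w + quadCoeff ρ F G₀ μ w u w w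
          + quadCoeff ρ F G₀ μ w w u w + quadCoeff ρ F G₀ μ w w w u)
      + (ε : ℂ) ^ 4 * quadCoeff ρ F G₀ μ w w w w := by
  simp only [quadCoeff_add₁ hG₀ hsm hcs μ, quadCoeff_add₂ hG₀ hsm hcs μ, quadCoeff_add₃ hG₀ hsm hcs μ,
    quadCoeff_add₄ hG₀ hsm hcs μ, quadCoeff_smul₁, quadCoeff_smul₂, quadCoeff_smul₃, quadCoeff_smul₄,
    Complex.conj_ofReal]
  ring

omit [TopologicalSpace G] [IsTopologicalGroup G] [BorelSpace G] hG₀ hsm hcs in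
/-- **Homogeneity**: `Q(r x) = r⁴ Q(x)` for real `r`. [folklore] -/
theorem quadCoeff_self_smul_real (r : ℝ) (x : V) :
    quadCoeff ρ F G₀ μ ((r : ℂ) • x) ((r : ℂ) • x) ((r : ℂ) • x) ((r : ℂ) • x) =
      (r : ℂ) ^ 4 * quadCoeff ρ F G₀ μ x x x x := by
  rw [quadCoeff_smul₁, quadCoeff_smul₂, quadCoeff_smul₃, quadCoeff_smul₄, Complex.conj_ofReal]
  ring

omit [TopologicalSpace G] [IsTopologicalGroup G] [BorelSpace G] hG₀ hsm hcs in
/-- **The Hecke vector represents `Q₄(·, u, u, u)`**: if `ũ(t) = ∫ e_u ũ(ρ(·) u)` for all linear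
forms then `⟪F w, F t⟫ = Q₄(w, u, u, u)` for every `w ∈ V`
(`e_u(h) ⟪F w, F(ρ(h) u)⟫ = c_{w,u}(h) conj c_{u,u}(h)`). [folklore] -/
theorem inner_heckeVector_eq_quadCoeff {u t : V}
    (ht : ∀ ut : Module.Dual ℂ V, ut t = ∫ h, eCoeff ρ F G₀ u h * ut (ρ h u) ∂μ) (w : V) :
    ⟪F w, F t⟫_ℂ = quadCoeff ρ F G₀ μ w u u u := by
  have h1 : ⟪F w, F t⟫_ℂ = ((innerₛₗ ℂ (F w)).comp F) t := by
    rw [LinearMap.comp_apply, innerₛₗ_apply_apply]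
  rw [h1, ht, quadCoeff_apply]
  congr 1 with h
  rw [LinearMap.comp_apply, innerₛₗ_apply_apply, eCoeff_apply]
  by_cases hh : h ∈ G₀
  · rw [cutCoeff_of_mem hh w u, mul_comm]
  · rw [cutCoeff_of_not_mem hh, cutCoeff_of_not_mem hh, map_zero, zero_mul, zero_mul]

/-- **Existence of a maximiser of `Q` on the unit sphere of `V^{K₁}`** (finite-dimensional by
admissibility; `Q` is a continuous quartic form for the norm `x ↦ ‖F x‖`, the sphere is compact).
[folklore] -/
theorem exists_isMaxOn_quadCoeff_self [IsFiniteMeasureOnCompacts μ] (hFi : Function.Injective F)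
    (E : Submodule ℂ V) [Module.Finite ℂ E] (hne : ∃ v ∈ E, v ≠ 0) :
    ∃ u ∈ E, ‖F u‖ = 1 ∧ ∀ x ∈ E, ‖F x‖ = 1 →
      (quadCoeff ρ F G₀ μ x x x x).re ≤ (quadCoeff ρ F G₀ μ u u u u).re := by
  -- the norm `x ↦ ‖F x‖` on `E`
  let f : E →ₗ[ℂ] H := F.comp E.subtype
  have hf : Function.Injective f := hFi.comp Subtype.val_injective
  letI : NormedAddCommGroup E := NormedAddCommGroup.induced E H f hf
  letI : NormedSpace ℂ E := NormedSpace.induced ℂ E H f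
  haveI : FiniteDimensional ℂ E := ‹Module.Finite ℂ E›
  have hnorm : ∀ x : E, ‖x‖ = ‖F (x : V)‖ := fun x => rfl
  -- `Q` on `E` as a polynomial in the coordinates of a basis
  let b := Module.finBasis ℂ E
  set QE : E → ℝ := fun x => (quadCoeff ρ F G₀ μ (x : V) x x x).re with hQE
  have hrepr : ∀ x : E, ((x : E) : V) = ∑ i, b.repr x i • ((b i : E) : V) := by
    intro x
    conv_lhs => rw [← b.sum_repr x]
    rw [Submodule.coe_sum]
    rfl
  have hexp : ∀ x : E, quadCoeff ρ F G₀ μ (x : V) x x x =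
      ∑ i, ∑ j, ∑ k, ∑ l, conj (b.repr x i) * b.repr x j * b.repr x k * conj (b.repr x l) *
        quadCoeff ρ F G₀ μ ((b i : E) : V) (b j : E) (b k : E) (b l : E) := by
    intro x
    -- expand the four slots one after the other
    have s1 : ∀ (z : E) (y x' y' : V),
        quadCoeff ρ F G₀ μ (∑ i, b.repr z i • ((b i : E) : V)) y x' y' =
          ∑ i, conj (b.repr z i) * quadCoeff ρ F G₀ μ ((b i : E) : V) y x' y' := by
      intro z y x' y'
      induction (Finset.univ : Finset (Fin (Module.finrank ℂ E))) using Finset.induction_on with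
      | empty => simp only [Finset.sum_empty, quadCoeff_zero₁]
      | @insert a T haT ih =>
        rw [Finset.sum_insert haT, Finset.sum_insert haT, quadCoeff_add₁ hG₀ hsm hcs μ, quadCoeff_smul₁, ih]
    have s2 : ∀ (z : E) (x x' y' : V),
        quadCoeff ρ F G₀ μ x (∑ i, b.repr z i • ((b i : E) : V)) x' y' =
          ∑ i, b.repr z i * quadCoeff ρ F G₀ μ x ((b i : E) : V) x' y' := by
      intro z x x' y'
      induction (Finset.univ : Finset (Fin (Module.finrank ℂ E))) using Finset.induction_on with
      | empty => simp only [Finset.sum_empty, quadCoeff_zero₂]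
      | @insert a T haT ih =>
        rw [Finset.sum_insert haT, Finset.sum_insert haT, quadCoeff_add₂ hG₀ hsm hcs μ, quadCoeff_smul₂, ih]
    have s3 : ∀ (z : E) (x y y' : V),
        quadCoeff ρ F G₀ μ x y (∑ i, b.repr z i • ((b i : E) : V)) y' =
          ∑ i, b.repr z i * quadCoeff ρ F G₀ μ x y ((b i : E) : V) y' := by
      intro z x y y'
      induction (Finset.univ : Finset (Fin (Module.finrank ℂ E))) using Finset.induction_on with
      | empty => simp only [Finset.sum_empty, quadCoeff_zero₃]
      | @insert a T haT ih =>
        rw [Finset.sum_insert haT, Finset.sum_insert haT, quadCoeff_add₃ hG₀ hsm hcs μ, quadCoeff_smul₃, ih]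
    have s4 : ∀ (z : E) (x y x' : V),
        quadCoeff ρ F G₀ μ x y x' (∑ i, b.repr z i • ((b i : E) : V)) =
          ∑ i, conj (b.repr z i) * quadCoeff ρ F G₀ μ x y x' ((b i : E) : V) := by
      intro z x y x'
      induction (Finset.univ : Finset (Fin (Module.finrank ℂ E))) using Finset.induction_on with
      | empty => simp only [Finset.sum_empty, quadCoeff_zero₄]
      | @insert a T haT ih =>
        rw [Finset.sum_insert haT, Finset.sum_insert haT, quadCoeff_add₄ hG₀ hsm hcs μ, quadCoeff_smul₄, ih]
    have e1 := s1 x (∑ i, b.repr x i • ((b i : E) : V)) (∑ i, b.repr x i • ((b i : E) : V))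
      (∑ i, b.repr x i • ((b i : E) : V))
    have e2 : ∀ i, quadCoeff ρ F G₀ μ ((b i : E) : V) (∑ i, b.repr x i • ((b i : E) : V))
        (∑ i, b.repr x i • ((b i : E) : V)) (∑ i, b.repr x i • ((b i : E) : V)) =
        ∑ j, b.repr x j * quadCoeff ρ F G₀ μ ((b i : E) : V) ((b j : E) : V)
          (∑ i, b.repr x i • ((b i : E) : V)) (∑ i, b.repr x i • ((b i : E) : V)) :=
      fun i => s2 x _ _ _
    have e3 : ∀ i j, quadCoeff ρ F G₀ μ ((b i : E) : V) ((b j : E) : V)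
        (∑ i, b.repr x i • ((b i : E) : V)) (∑ i, b.repr x i • ((b i : E) : V)) =
        ∑ k, b.repr x k * quadCoeff ρ F G₀ μ ((b i : E) : V) ((b j : E) : V) ((b k : E) : V)
          (∑ i, b.repr x i • ((b i : E) : V)) :=
      fun i j => s3 x _ _ _
    have e4 : ∀ i j k, quadCoeff ρ F G₀ μ ((b i : E) : V) ((b j : E) : V) ((b k : E) : V)
        (∑ i, b.repr x i • ((b i : E) : V)) =
        ∑ l, conj (b.repr x l) * quadCoeff ρ F G₀ μ ((b i : E) : V) ((b j : E) : V) ((b k : E) : V)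
          ((b l : E) : V) :=
      fun i j k => s4 x _ _ _
    conv_lhs => rw [hrepr x]
    rw [e1]
    refine Finset.sum_congr rfl fun i _ => ?_
    rw [e2 i, Finset.mul_sum]
    refine Finset.sum_congr rfl fun j _ => ?_
    rw [e3 i j, Finset.mul_sum, Finset.mul_sum]
    refine Finset.sum_congr rfl fun k _ => ?_
    rw [e4 i j k, Finset.mul_sum, Finset.mul_sum, Finset.mul_sum]
    refine Finset.sum_congr rfl fun l _ => ?_
    ring
  have hcoord : ∀ i, Continuous fun x : E => b.repr x i := fun i =>
    LinearMap.continuous_of_finiteDimensional (b.coord i)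
  have hQEc : Continuous QE := by
    have : QE = fun x : E => (∑ i, ∑ j, ∑ k, ∑ l, conj (b.repr x i) * b.repr x j * b.repr x k *
        conj (b.repr x l) * quadCoeff ρ F G₀ μ ((b i : E) : V) (b j : E) (b k : E) (b l : E)).re := by
      funext x
      rw [hQE]
      dsimp only
      rw [hexp x]
    rw [this]
    refine Complex.continuous_re.comp (continuous_finsetSum _ fun i _ => continuous_finsetSum _ fun j _ =>
      continuous_finsetSum _ fun k _ => continuous_finsetSum _ fun l _ => ?_)
    exact ((((Complex.continuous_conj.comp (hcoord i)).mul (hcoord j)).mul (hcoord k)).mul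
      (Complex.continuous_conj.comp (hcoord l))).mul continuous_const
  -- the unit sphere of `E` is compact and non-empty
  obtain ⟨v, hvE, hv0⟩ := hne
  have hv0' : (⟨v, hvE⟩ : E) ≠ 0 := fun h => hv0 (congrArg Subtype.val h)
  set x₀ : E := ((‖(⟨v, hvE⟩ : E)‖ : ℂ)⁻¹) • (⟨v, hvE⟩ : E) with hx₀
  have hx₀s : x₀ ∈ Metric.sphere (0 : E) 1 := by
    rw [mem_sphere_zero_iff_norm, hx₀, norm_smul, norm_inv, Complex.norm_real, Real.norm_of_nonneg (norm_nonneg _),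
      inv_mul_cancel₀ (norm_ne_zero_iff.2 hv0')]
  obtain ⟨u, hus, hmax⟩ := (isCompact_sphere (0 : E) 1).exists_isMaxOn ⟨x₀, hx₀s⟩ hQEc.continuousOn
  refine ⟨(u : V), u.2, ?_, fun x hxE hx1 => ?_⟩
  · rw [← hnorm]
    exact mem_sphere_zero_iff_norm.1 hus
  · have hxs : (⟨x, hxE⟩ : E) ∈ Metric.sphere (0 : E) 1 := by
      rw [mem_sphere_zero_iff_norm, hnorm]
      exact hx1
    exact hmax hxs

/-- **First-order condition at a maximiser.** Let `E ≤ V` be a subspace, `u ∈ E` with `‖F u‖ = 1`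
maximising `Q` on the unit sphere of `E`, and `w ∈ E` with `⟪F u, F w⟫ = 0`. Then
`Q₄(w, u, u, u) = 0`. Proof: `Q(u + εw) ≤ ‖F(u + εw)‖⁴ Q(u) = (1 + ε²‖Fw‖²)² Q(u)` for all real
`ε` (homogeneity and maximality); the linear coefficient of the left side is
`Q₄(w,u,u,u) + Q₄(u,w,u,u) + Q₄(u,u,w,u) + Q₄(u,u,u,w) = 4 Re Q₄(w,u,u,u)` by the Hermitian and the
inversion symmetries, so it vanishes (`eq_zero_of_forall_quartic_le`); replacing `w` by `i w` kills
the imaginary part. [folklore] -/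
theorem quadCoeff_eq_zero_of_isMaxOn [IsFiniteMeasureOnCompacts μ] [μ.IsInvInvariant]
    (hF : ∀ (g : G) (x y : V), ⟪F (ρ g x), F (ρ g y)⟫_ℂ = ⟪F x, F y⟫_ℂ)
    (E : Submodule ℂ V) {u : V} (huE : u ∈ E) (hu1 : ‖F u‖ = 1)
    (hmax : ∀ x ∈ E, ‖F x‖ = 1 → (quadCoeff ρ F G₀ μ x x x x).re ≤ (quadCoeff ρ F G₀ μ u u u u).re)
    {w : V} (hwE : w ∈ E) (hw : ⟪F u, F w⟫_ℂ = 0) :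
    quadCoeff ρ F G₀ μ w u u u = 0 := by
  -- Step 1: the real part vanishes, for every `w ∈ E` orthogonal to `u`
  have step : ∀ w ∈ E, ⟪F u, F w⟫_ℂ = 0 → (quadCoeff ρ F G₀ μ w u u u).re = 0 := by
    intro w hwE hw
    set z := quadCoeff ρ F G₀ μ w u u u with hz
    set Qu := (quadCoeff ρ F G₀ μ u u u u).re with hQu
    set nw := ‖F w‖ with hnw
    -- the linear coefficient is `4 Re z`
    have hL : quadCoeff ρ F G₀ μ w u u u + quadCoeff ρ F G₀ μ u w u u
        + quadCoeff ρ F G₀ μ u u w u + quadCoeff ρ F G₀ μ u u u w = 2 * z + 2 * conj z := by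
      have h2 : quadCoeff ρ F G₀ μ u w u u = quadCoeff ρ F G₀ μ u u w u := quadCoeff_swap_inv hF u w u u
      have h3 : quadCoeff ρ F G₀ μ u u w u = conj z := quadCoeff_conj_symm u u w u
      have h4 : quadCoeff ρ F G₀ μ u u u w = conj (quadCoeff ρ F G₀ μ u w u u) := quadCoeff_conj_symm u u u w
      rw [h4, h2, h3, Complex.conj_conj]
      ring
    have hLre : (quadCoeff ρ F G₀ μ w u u u + quadCoeff ρ F G₀ μ u w u u
        + quadCoeff ρ F G₀ μ u u w u + quadCoeff ρ F G₀ μ u u u w).re = 4 * z.re := by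
      rw [hL]
      simp only [Complex.add_re, Complex.mul_re, Complex.conj_re, Complex.conj_im, Complex.re_ofNat,
        Complex.im_ofNat]
      ring
    -- the quartic inequality in `ε`
    have hineq : ∀ ε : ℝ,
        ε * (4 * z.re)
        + ε ^ 2 * ((quadCoeff ρ F G₀ μ w w u u + quadCoeff ρ F G₀ μ w u w u
            + quadCoeff ρ F G₀ μ w u u w + quadCoeff ρ F G₀ μ u w w u
            + quadCoeff ρ F G₀ μ u w u w + quadCoeff ρ F G₀ μ u u w w).re - 2 * nw ^ 2 * Qu)
        + ε ^ 3 * (quadCoeff ρ F G₀ μ u w w w + quadCoeff ρ F G₀ μ w u w w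
            + quadCoeff ρ F G₀ μ w w u w + quadCoeff ρ F G₀ μ w w w u).re
        + ε ^ 4 * ((quadCoeff ρ F G₀ μ w w w w).re - nw ^ 4 * Qu) ≤ 0 := by
      intro ε
      simp only [Complex.add_re]
      set v : V := u + (ε : ℂ) • w with hv
      have hvE : v ∈ E := E.add_mem huE (E.smul_mem _ hwE)
      -- `‖F v‖² = 1 + ε² ‖F w‖²`
      have hFv : F v = F u + (ε : ℂ) • F w := by rw [hv, map_add, map_smul]
      have horth : ⟪F u, (ε : ℂ) • F w⟫_ℂ = 0 := by rw [inner_smul_right, hw, mul_zero]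
      have hnorm2 : ‖F v‖ ^ 2 = 1 + ε ^ 2 * nw ^ 2 := by
        have h1 := norm_add_sq_eq_norm_sq_add_norm_sq_of_inner_eq_zero (F u) ((ε : ℂ) • F w) horth
        rw [← hFv, hu1, norm_smul, Complex.norm_real, Real.norm_eq_abs] at h1
        nlinarith [h1, sq_abs ε]
      set N := ‖F v‖ with hN
      have hN0 : 0 ≤ N := by rw [hN]; exact norm_nonneg _
      have hNpos : 0 < N := by nlinarith [hnorm2, sq_nonneg (ε * nw), hN0, sq_nonneg N]
      -- the normalised vector lies on the sphere
      set x : V := ((N⁻¹ : ℝ) : ℂ) • v with hx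
      have hxE : x ∈ E := E.smul_mem _ hvE
      have hx1 : ‖F x‖ = 1 := by
        rw [hx, map_smul, norm_smul, Complex.norm_real, Real.norm_of_nonneg (inv_nonneg.2 hNpos.le),
          inv_mul_cancel₀ hNpos.ne']
      -- maximality and homogeneity: `Re Q(v) ≤ N⁴ Re Q(u)`
      have hQx : (quadCoeff ρ F G₀ μ x x x x).re = (N⁻¹) ^ 4 * (quadCoeff ρ F G₀ μ v v v v).re := by
        rw [hx, quadCoeff_self_smul_real μ, ← Complex.ofReal_pow, Complex.re_ofReal_mul]
      have hle := hmax x hxE hx1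
      rw [hQx] at hle
      have hle' : (quadCoeff ρ F G₀ μ v v v v).re ≤ N ^ 4 * Qu := by
        have hN4 : 0 < N ^ 4 := by positivity
        have := mul_le_mul_of_nonneg_left hle hN4.le
        rwa [← mul_assoc, ← mul_pow, mul_inv_cancel₀ hNpos.ne', one_pow, one_mul] at this
      -- the expansion of `Q(v)`
      have hexp := quadCoeff_self_add_smul hG₀ hsm hcs μ u w ε
      rw [← hv] at hexp
      have hexp_re := congrArg Complex.re hexp
      simp only [Complex.add_re, ← Complex.ofReal_pow, Complex.re_ofReal_mul] at hexp_re
      have hLre' : (quadCoeff ρ F G₀ μ w u u u).re + (quadCoeff ρ F G₀ μ u w u u).re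
          + (quadCoeff ρ F G₀ μ u u w u).re + (quadCoeff ρ F G₀ μ u u u w).re = 4 * z.re := by
        simpa only [Complex.add_re] using hLre
      rw [hLre'] at hexp_re
      have hN4 : N ^ 4 = (1 + ε ^ 2 * nw ^ 2) ^ 2 := by
        rw [show (4 : ℕ) = 2 * 2 from rfl, pow_mul, hnorm2]
      rw [hN4] at hle'
      rw [hexp_re] at hle'
      nlinarith [hle']
    have := eq_zero_of_forall_quartic_le hineq
    linarith
  -- Step 2: real and imaginary parts
  have hre : (quadCoeff ρ F G₀ μ w u u u).re = 0 := step w hwE hw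
  have him : (quadCoeff ρ F G₀ μ w u u u).im = 0 := by
    have hIw : Complex.I • w ∈ E := E.smul_mem _ hwE
    have hIw' : ⟪F u, F (Complex.I • w)⟫_ℂ = 0 := by rw [map_smul, inner_smul_right, hw, mul_zero]
    have h := step (Complex.I • w) hIw hIw'
    rw [quadCoeff_smul₁, Complex.conj_I] at h
    simpa [Complex.mul_re] using h
  exact Complex.ext hre him

/-- **Main theorem: a unit vector `u ∈ V^{K₁}` with `ρ(e_u) u = c u`, `c > 0`.** Data: a smooth
representation `ρ` of `G` on `V`; an injective linear `F : V → H` to a complex inner product space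
with `⟪F(ρ g x), F(ρ g y)⟫ = ⟪F x, F y⟫` (unitarity); an open subgroup `G₀` on which all cut-off
coefficients `c_{x,y} = 1_{G₀} ⟪F x, F(ρ(·) y)⟫` have compact support; a measure `μ` finite on
compacts, positive on opens, left invariant and inversion invariant (a Haar measure of a unimodular
group); a subgroup `K₁ ≤ G₀` with `V^{K₁}` finite-dimensional (admissibility) and non-zero. Then
there are `u ∈ V^{K₁}` with `‖F u‖ = 1` and `c > 0` such that for every linear form `ũ` on `V`

  `∫ e_u(h) ũ(ρ(h) u) dμ(h) = c ũ(u)`,   `e_u(h) = 1_{G₀}(h) ⟪F(ρ(h) u), F u⟫`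

— i.e. `ρ(e_u) u = c u` for the Hecke vector `ρ(e_u) u`; hence `e_u ⋆ e_u = c e_u`, `e_u^* = e_u`
(Gelbart (1975), (10.11), without central character). Take `u` a maximiser of `Q` on the unit
sphere of `V^{K₁}` (`exists_isMaxOn_quadCoeff_self`), `t = ρ(e_u) u` (`exists_heckeVector`,
`∈ V^{K₁}` by `heckeVector_mem_fixedPoints`), `c = Q(u)`; `⟪F w, F t⟫ = Q₄(w,u,u,u)` vanishes for
`w ∈ V^{K₁}` orthogonal to `u` (`quadCoeff_eq_zero_of_isMaxOn`), so `t - c u`, which is such a `w`,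
is `0`. [cite: Gelbart1975, (10.11)] -/
theorem exists_eCoeff_eigenvector [IsFiniteMeasureOnCompacts μ] [μ.IsOpenPosMeasure]
    [μ.IsMulLeftInvariant] [μ.IsInvInvariant]
    (hF : ∀ (g : G) (x y : V), ⟪F (ρ g x), F (ρ g y)⟫_ℂ = ⟪F x, F y⟫_ℂ) (hFi : Function.Injective F)
    {K₁ : Subgroup G} (hK₁ : K₁ ≤ G₀) [Module.Finite ℂ (ρ.fixedPoints K₁)]
    (hne : ∃ v ∈ ρ.fixedPoints K₁, v ≠ 0) :
    ∃ u ∈ ρ.fixedPoints K₁, ‖F u‖ = 1 ∧ ∃ c : ℝ, 0 < c ∧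
      ∀ ut : Module.Dual ℂ V, ∫ h, eCoeff ρ F G₀ u h * ut (ρ h u) ∂μ = c * ut u := by
  set E := ρ.fixedPoints K₁ with hE
  obtain ⟨u, huE, hu1, hmax⟩ := exists_isMaxOn_quadCoeff_self hG₀ hsm hcs μ hFi E hne
  obtain ⟨t, ht⟩ := exists_heckeVector hG₀ hsm hcs μ u
  have htE : t ∈ E := heckeVector_mem_fixedPoints μ hF hK₁ huE ht
  have hu0 : u ≠ 0 := by
    intro h
    rw [h, map_zero, norm_zero] at hu1
    exact zero_ne_one hu1
  set c : ℝ := (quadCoeff ρ F G₀ μ u u u u).re with hc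
  have hcpos : 0 < c := quadCoeff_self_re_pos hG₀ hsm hcs μ hFi hu0
  have hQu : quadCoeff ρ F G₀ μ u u u u = (c : ℂ) :=
    Complex.ext (by rw [Complex.ofReal_re]) (by rw [Complex.ofReal_im, quadCoeff_self_im])
  have hinner : ∀ w, ⟪F w, F t⟫_ℂ = quadCoeff ρ F G₀ μ w u u u :=
    inner_heckeVector_eq_quadCoeff μ ht
  have huu : ⟪F u, F u⟫_ℂ = 1 := by
    rw [inner_self_eq_norm_sq_to_K, hu1]; norm_num
  -- `w₀ = t - c u` is in `E` and orthogonal to `u`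
  set w₀ : V := t - (c : ℂ) • u with hw₀
  have hw₀E : w₀ ∈ E := E.sub_mem htE (E.smul_mem _ huE)
  have hw₀orth : ⟪F u, F w₀⟫_ℂ = 0 := by
    rw [hw₀, map_sub, map_smul, inner_sub_right, inner_smul_right, huu, mul_one, hinner u, hQu, sub_self]
  have hq0 : quadCoeff ρ F G₀ μ w₀ u u u = 0 :=
    quadCoeff_eq_zero_of_isMaxOn hG₀ hsm hcs μ hF E huE hu1 hmax hw₀E hw₀orth
  -- hence `F w₀ ⊥ F t = F w₀ + c F u`, so `F w₀ = 0`
  have hFt : F t = F w₀ + (c : ℂ) • F u := by rw [hw₀, map_sub, map_smul, sub_add_cancel]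
  have h0 : ⟪F w₀, F w₀⟫_ℂ = 0 := by
    have h1 : ⟪F w₀, F t⟫_ℂ = 0 := by rw [hinner, hq0]
    rw [hFt, inner_add_right, inner_smul_right, ← inner_conj_symm (F w₀) (F u), hw₀orth, map_zero,
      mul_zero, add_zero] at h1
    exact h1
  have hw₀0 : w₀ = 0 := hFi (by rw [inner_self_eq_zero.1 h0, map_zero])
  have htcu : t = (c : ℂ) • u := by rw [← sub_eq_zero]; exact hw₀0
  refine ⟨u, huE, hu1, c, hcpos, fun ut => ?_⟩
  rw [← ht ut, htcu, map_smul, smul_eq_mul]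

end Variational

end CutoffCoefficient

end Literature.NumberTheory.Automorphic
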